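/-
Copyright (c) 2026 the pub-hodgecm-mathlib formalisation cell (harness21).  Prover seat hodgecm-mathlib-LH4-p17 (g0), req620 Track A «(D-RAM) FOUR-FRAME» squad, helper lane on
h413 = stmt-HodgeConjecture-24833 (count-neutral).  β-BOARD v1 (sub-dealer LH4-p05 (g8)) row R3 «G₁ ε-BOUNDARY TOWER FILE» — slots 0 and 1 of the head.  2026-09-04.
-/
import Summits.HodgeConjecture.HodgeConjecture.Theorems.F0P3cDyRamLabelledOddBoundaryG1Orbits      -- ★ (this seat): the orbit kit — shell, representatives, decomposition, ratio, per-orbit value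
import Summits.HodgeConjecture.HodgeConjecture.Theorems.F0P3cDyRamLabelledOddBoundarySums          -- ★ p861608 (this seat, FILE 4): the orbit character sums
import Summits.HodgeConjecture.HodgeConjecture.Theorems.F0P3cDyRamDiagonalKappaGluedDecomposition   -- ★: `orbit_mass_eq_pow`
import Summits.HodgeConjecture.HodgeConjecture.Theorems.F0P3cDyRamDiagonalGluedStabiliserIndex      -- ★: `stabiliserWeight_latt_glued_tube_eq`
import HarnessLib

/-!
# Crux `H413`, line LH4 «(D-RAM) FOUR-FRAME» — (β) Stage B, β-BOARD R3 (slots 0 and 1): THE `G₁` CAPPED TUBE CLASSES BEYOND THE ONE-SLOT CELL, OWN SLOT AND READ SLOT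
# `|𝒯-orbit| · Σ_{g ∈ R} value₀(latt V(1,1,g)) = 0`,  `|𝒯-orbit| · Σ_{g ∈ R} value₁(latt V(1,1,g)) = ω(e_B)∕2 · q^{2ρ+s∕2−1} · F(n₂)`

Cell `hodgecm-mathlib` (D-0151), FLOOR 0, crux item H413 = `stmt-HodgeConjecture-24833`, route `HCCMUnconditional`; squad F0∕P3c∕LH4.  THEOREMS ONLY (no `def`, no instance, no
notation, no `sorry`, default heartbeats); ★-only imports; lane `--supports stmt-HodgeConjecture-24833 --as helper` (count-neutral); pays NO row, states NO law.  Slots `0` and `1` of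
the R3 head `F0P3cDyRamLabelledOddBoundaryG1.finsum_stratum_G1_beyond_shell_labelledOdd_div_relIndex_eq`: on each representative the per-orbit value of ★ `…BoundaryG1Orbits` §5, the
indicator `[2d ≤ ρ+1]` ∕ `[2d ≤ ρ+(n₂−ℓ₀−2ρ)+1]` (★ p861560 §4), the orbit sums `Σ ω(g)ω(1+rg) = 0` ∕ `Σ ω(1+rg)` (★ p861608: boundary `n₂+2 = 2d+ℓ₀+2ρ` or dead), the mass
`|orbit|·w = q^{2ρ+s−⌈(ρ+s)∕2⌉}` (★ `orbit_mass_eq_pow`, ★ `stabiliserWeight_latt_glued_tube_eq`).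
HONEST LABEL.  Count-neutral helpers; `HC_CM` is proved only modulo the 7 printed citations (2 remaining named inputs: hLiu418 = `stmt-HodgeConjecture-24832`, h413 =
`stmt-HodgeConjecture-24833`) until rung 0 closes.
References: [Kottwitz1986BaseChangeUnits] §1 pp. 240–241 · [Rogawski1990] §4.9 Prop. 4.9.1 (a)(b) p. 55, §4.10 p. 58 · [LanglandsShelstad1987] §3 · [Serre1979] Ch. V §3, Ch. XV §2.
-/

set_option autoImplicit false

noncomputable section

namespace Summit.HodgeConjecture.HodgeConjecture.Cruxes.H413.F0P3cDyRamLabelledOddBoundaryG1Slots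
open Matrix WithZero
open Literature.NumberTheory.Automorphic Literature.NumberTheory.Automorphic.HermitianLattice Literature.NumberTheory.Automorphic.UnitaryGroup
open Literature.NumberTheory.Automorphic.UnitaryLatticeTree Literature.NumberTheory.Automorphic.UnitaryThreeFourFrame
open Literature.NumberTheory.LocalFields Literature.NumberTheory.LocalFields.WildQuadraticDatum
open Summit.HodgeConjecture.HodgeConjecture.Cruxes.H413.F0P3cDyRamFourFramePieces
open Summit.HodgeConjecture.HodgeConjecture.Cruxes.H413.F0P3cDyRamFourFrameCensusDefs
open Summit.HodgeConjecture.HodgeConjecture.Cruxes.H413.F0P3cDyRamStageOneBDefs (mcOfRecord)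
open Summit.HodgeConjecture.HodgeConjecture.Cruxes.H413.F0P3cDyRamStageOneBDerivedDefs (n0DerivedOfRecord mcOfRecord_le_n0DerivedOfRecord)
open Summit.HodgeConjecture.HodgeConjecture.Cruxes.H413.F0P3cDyRamDiagonalTorusDefs
open Summit.HodgeConjecture.HodgeConjecture.Cruxes.H413.F0P3cDyRamDiagonalStrataDefs
open Summit.HodgeConjecture.HodgeConjecture.Cruxes.H413.F0P3cDyRamDiagonalKappaCountDefs
open Summit.HodgeConjecture.HodgeConjecture.Cruxes.H413.F0P3cDyRamLabelledOddCountDefs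
open Summit.HodgeConjecture.HodgeConjecture.Cruxes.H413.F0P3cDyRamDiagonalGluedStabiliserIndex (stabiliserWeight_latt_glued_tube_eq ne_zero_and_v_lt_one_of_v_eq_exp)
open Summit.HodgeConjecture.HodgeConjecture.Cruxes.H413.F0P3cDyRamDiagonalKappaGluedDecomposition (orbit_mass_eq_pow)
open Summit.HodgeConjecture.HodgeConjecture.Cruxes.H413.F0P3cDyRamDiagonalKappaCoreHangingClass (two_le_d_of_v_two_lt_one)
open Summit.HodgeConjecture.HodgeConjecture.Cruxes.H413.F0P3cDyRamLabelledOddGluedCharacter (forall_normSign_zero_mul_gluedChar_iff forall_normSign_one_mul_gluedChar_iff)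
open Summit.HodgeConjecture.HodgeConjecture.Cruxes.H413.F0P3cDyRamLabelledOddBoundarySums
open Summit.HodgeConjecture.HodgeConjecture.Cruxes.H413.F0P3cDyRamLabelledOddBoundaryG1Orbits (value_latt_glued_rep_eq normSign_unit_mul_normPow_mul)
open scoped Valued WithZero Matrix MatrixGroups
variable {K : Type} [Field K] [Valued K ℤᵐ⁰] [CompleteSpace K] [Fintype 𝓀[K]] {σ : K →+* K} {ϖ : K} {d t : ℕ} {α β : K} {n₁ n₂ n₃ : ℕ}

/-! ## §1  Slot `0` (own slot) and slot `1` (read slot): indicator, orbit sum, arithmetic -/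

/-- **SLOT 0** (the own slot): the indicator is `[2d ≤ ρ+1]` (★ p861560 §4), and in that window `Σ_{g ∈ R} ω(g)·ω(1+rg) = 0` (★ p861608); total `0`.
[cite: Rogawski1990, §4.9 Prop. 4.9.1 (b) p. 55] [cite: Serre1979, Ch. XV §2] -/
theorem card_mul_sum_value_zero_eq (h2 : Valued.v (2 : K) < 1) (hD : IsRamifiedQuadraticDatum σ ϖ d t)
    (hE : IsElementDatum σ ϖ (n0DerivedOfRecord d) α β n₁ n₂ n₃)
    (T : GL (Fin 3) K) (hT : (T : Matrix (Fin 3) (Fin 3) K) = Matrix.diagonal ![α, β, 1]) (ρ t' : ℕ) (hρ : 1 ≤ ρ) (ht' : 1 ≤ t')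
    (hbey : n₂ < 2 * ρ + (d % 2 + 2 * d - 1)) (hread : 2 * ρ + 2 * t' + d % 2 = n₁) (hcap : 2 * ρ + 2 + d % 2 ≤ min n₂ n₃)
    {eB : K} (hσeB : σ eB = eB) (heB1 : Valued.v eB = 1)
    (R : Finset K) (hR1' : ∀ g ∈ R, σ g = g ∧ Valued.v g = Valued.v ϖ ^ (2 * t'))
    (hR2' : ∀ f : K, σ f = f → Valued.v f = Valued.v ϖ ^ (2 * t') → ∃ g ∈ R, Valued.v (f - g) ≤ Valued.v ϖ ^ (ρ + 2 * t'))
    (hR3' : ∀ g ∈ R, ∀ g' ∈ R, Valued.v (g - g') ≤ Valued.v ϖ ^ (ρ + 2 * t') → g = g')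
    (hRcard : R.card = (Nat.card 𝓀[K] - 1) * Nat.card 𝓀[K] ^ ((ρ + 1) / 2 - 1))
    (V₀ : K → GL (Fin 3) K) (hV₀ : ∀ g, (V₀ g : Matrix (Fin 3) (Fin 3) K) = !![1, 0, 0; 1, ϖ ^ ρ, 0; 1 * 1 + g, ϖ ^ ρ * 1, ϖ ^ (2 * ρ + 2 * t')])
    {r : K} (hσr : σ r = r) (j₁ : ℕ) (hj₁ : n₂ = 2 * ρ + 2 * j₁ + d % 2)
    (hprecα : ∀ g ∈ R, Valued.v ((ϖ ^ (d % 2 + 2 * d - 1))⁻¹ * (((ϖ * σ ϖ) ^ (ρ + t'))⁻¹ * g *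
      ((α - 1) - r * (eB * (ϖ * σ ϖ) ^ (ρ + t')) * ((ϖ - σ ϖ) * ((ϖ * σ ϖ) ^ ((d - d % 2) / 2))⁻¹)))) ≤ 1)
    (hprecβ : Valued.v ((ϖ ^ (d % 2 + 2 * d - 1))⁻¹ * (((ϖ * σ ϖ) ^ (ρ + t'))⁻¹ *
      ((β - 1) - (eB * (ϖ * σ ϖ) ^ (ρ + t')) * ((ϖ - σ ϖ) * ((ϖ * σ ϖ) ^ ((d - d % 2) / 2))⁻¹)))) ≤ 1)
    (hvrg : ∀ g ∈ R, Valued.v (r * g) = Valued.v ϖ ^ (2 * j₁)) (hvr2t : Valued.v r * Valued.v ϖ ^ (2 * t') = Valued.v ϖ ^ (2 * j₁)) :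
    ((((Nat.card 𝓀[K] - 1) * Nat.card 𝓀[K] ^ (ρ + 2 * t' - 1)) * ((Nat.card 𝓀[K] - 1) * Nat.card 𝓀[K] ^ (2 * ρ - 1)) : ℕ) : ℚ) *
        ∑ g ∈ R, (labelledOddCount σ ϖ 0 0 (valueClassLabel σ ϖ (α - 1) (β - 1) (d % 2 + 2 * d - 1) d) (latt (V₀ g : Matrix (Fin 3) (Fin 3) K)) : ℚ) /
            ((((unitStabilizer (latt (V₀ g : Matrix (Fin 3) (Fin 3) K))).map (unitNormMap σ 3)).relIndex (fixedUnitTorus σ 3) : ℕ) : ℚ) = 0 := by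
  classical
  obtain ⟨hσ, hvσ, hϖ, hfix, hdd, hd1, ht₂⟩ := id hD
  have hd2 : 2 ≤ d := two_le_d_of_v_two_lt_one hD h2
  obtain ⟨hϖ0, hϖ1⟩ := ne_zero_and_v_lt_one_of_v_eq_exp hϖ
  have hvϖ : 0 < Valued.v ϖ := (Valuation.pos_iff _).2 hϖ0
  have hσϖ0 : σ ϖ ≠ 0 := (map_ne_zero σ).2 hϖ0
  have hpw : ∀ a b : ℕ, Valued.v ϖ ^ a ≤ Valued.v ϖ ^ b ↔ b ≤ a := fun a b => by
    rw [v_varpi_pow hϖ, v_varpi_pow hϖ, WithZero.exp_le_exp]; omega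
  have hpwi : ∀ a b : ℕ, Valued.v ϖ ^ a = Valued.v ϖ ^ b ↔ a = b := fun a b => by
    rw [v_varpi_pow hϖ, v_varpi_pow hϖ, WithZero.exp_inj]; omega
  obtain ⟨-, -, -, -, -, -, -, -, hN1, hN2, hN3⟩ := id hE
  have hmcN : mcOfRecord d ≤ n0DerivedOfRecord d := mcOfRecord_le_n0DerivedOfRecord d
  have hmcv : mcOfRecord d = 2 * ((d % 2 + 2 * d - 1 + d) / 2) := rfl
  have hj₁1 : 1 ≤ j₁ := by omega
  have hj₁d : j₁ + 1 ≤ d := by omega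
  have hq1 : 1 < Nat.card 𝓀[K] := Finite.one_lt_card
  have h11 : Valued.v (1 : K) = 1 := map_one _
  have hπ0 : ((ϖ * σ ϖ) ^ (ρ + t') : K) ≠ 0 := pow_ne_zero _ (mul_ne_zero hϖ0 hσϖ0)
  have hσπ : σ ((ϖ * σ ϖ) ^ (ρ + t')) = (ϖ * σ ϖ) ^ (ρ + t') := by rw [map_pow, map_mul, hσ, mul_comm]
  have heB0 : eB ≠ 0 := fun h => by rw [h, map_zero] at heB1; exact zero_ne_one heB1
  have hσgβ : σ (eB * (ϖ * σ ϖ) ^ (ρ + t')) = eB * (ϖ * σ ϖ) ^ (ρ + t') := by rw [map_mul, hσeB, hσπ]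
  have hgβ0 : eB * (ϖ * σ ϖ) ^ (ρ + t') ≠ 0 := mul_ne_zero heB0 hπ0
  have hrglt : ∀ g ∈ R, Valued.v (r * g) < 1 := fun g hg => by rw [hvrg g hg]; exact pow_lt_one₀ zero_le hϖ1 (by omega)
  have h1rg0 : ∀ g ∈ R, (1 : K) + r * g ≠ 0 := fun g hg h => by
    have h' := Valued.v.map_one_add_of_lt (hrglt g hg); rw [h, map_zero] at h'; exact zero_ne_one h'
  have hσ1rg : ∀ g ∈ R, σ (1 + r * g) = 1 + r * g := fun g hg => by rw [map_add, map_one, map_mul, hσr, (hR1' g hg).1]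
  have hc : ∀ g ∈ R, σ (r * g / (1 + r * g)) = r * g / (1 + r * g) := fun g hg => by rw [map_div₀, hσ1rg g hg, map_mul, hσr, (hR1' g hg).1]
  have hck : ∀ g ∈ R, Valued.v (r * g / (1 + r * g)) = Valued.v ϖ ^ (2 * j₁) := fun g hg => by
    rw [map_div₀, Valued.v.map_one_add_of_lt (hrglt g hg), div_one, hvrg g hg]
  -- the per-orbit value (★ Orbits §5), `ε(g) = ω(e_B)ω(1+rg)`, the weight, the mass
  have hval := fun g (hg : g ∈ R) => value_latt_glued_rep_eq h2 hD hE T hT ρ t' hρ ht' hread hcap (hR1' g hg).1 (hR1' g hg).2 (V₀ g) (hV₀ g)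
    hσr hσgβ hgβ0 (hprecα g hg) hprecβ j₁ hj₁ (hvrg g hg)
  have hεg : ∀ g ∈ R, (normSign σ (eB * (ϖ * σ ϖ) ^ (ρ + t') * (1 + r * g)) : ℚ) = normSign σ eB * normSign σ (1 + r * g) := fun g hg =>
    normSign_unit_mul_normPow_mul hD hσeB heB1 (hσ1rg g hg) (h1rg0 g hg) (ρ + t')
  have hw : ∀ g ∈ R, stabiliserWeight σ (latt (V₀ g : Matrix (Fin 3) (Fin 3) K)) =
      ((((Nat.card 𝓀[K] - 1) * Nat.card 𝓀[K] ^ ((ρ + 2 * t' + 1) / 2 - 1)) * ((Nat.card 𝓀[K] - 1) * Nat.card 𝓀[K] ^ (ρ - 1)) : ℕ) : ℚ)⁻¹ := fun g hg =>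
    stabiliserWeight_latt_glued_tube_eq hσ hvσ hfix hϖ hdd hρ t' h11 h11 (hR1' g hg).2 (V₀ g) (hV₀ g) (hR1' g hg).1
      (by rw [map_one, (hR1' g hg).1, one_mul, sub_self, map_zero]; exact zero_le)
  have hmass := orbit_mass_eq_pow hq1 hρ t'
  have hj : (ρ + 2 * t' + 1) / 2 = (ρ + 1) / 2 + t' := by
    rw [show ρ + 2 * t' + 1 = ρ + 1 + t' * 2 by ring, Nat.add_mul_div_right _ _ (by norm_num : 0 < 2)]
  have e1 : 2 * ρ + 2 * t' - (ρ + 2 * t' + 1) / 2 + ((ρ + 1) / 2 - 1) = 2 * ρ + t' - 1 := by rw [hj]; omega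
  have epow : (Nat.card 𝓀[K] : ℚ) ^ (2 * ρ + t' - 1) =
      (Nat.card 𝓀[K] : ℚ) ^ (2 * ρ + 2 * t' - (ρ + 2 * t' + 1) / 2) * (Nat.card 𝓀[K] : ℚ) ^ ((ρ + 1) / 2 - 1) := by rw [← pow_add, e1]
  have hRcardQ : (R.card : ℚ) = ((Nat.card 𝓀[K] : ℚ) - 1) * (Nat.card 𝓀[K] : ℚ) ^ ((ρ + 1) / 2 - 1) := by
    rw [hRcard]; push_cast [Nat.cast_sub hq1.le]; ring
  set Wn : ℕ := ((Nat.card 𝓀[K] - 1) * Nat.card 𝓀[K] ^ ((ρ + 2 * t' + 1) / 2 - 1)) * ((Nat.card 𝓀[K] - 1) * Nat.card 𝓀[K] ^ (ρ - 1)) with hWn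
  set Nn : ℕ := ((Nat.card 𝓀[K] - 1) * Nat.card 𝓀[K] ^ (ρ + 2 * t' - 1)) * ((Nat.card 𝓀[K] - 1) * Nat.card 𝓀[K] ^ (2 * ρ - 1)) with hNn
  have key : ∀ x : ℚ, (Nn : ℚ) * (((Wn : ℕ) : ℚ)⁻¹ * x) = (Nat.card 𝓀[K] : ℚ) ^ (2 * ρ + 2 * t' - (ρ + 2 * t' + 1) / 2) * x := fun x => by
    rw [← mul_assoc, hmass]
  by_cases hwin : 2 * d ≤ ρ + 1
  · rw [Finset.sum_congr rfl (fun g hg => by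
      rw [hval g hg 0, if_pos ((forall_normSign_zero_mul_gluedChar_iff hD h2 hρ ht' (hR1' g hg).1 (hR1' g hg).2 (V₀ g) (hV₀ g) (hc g hg) (k := 2 * j₁) (by omega)
        (hck g hg).le).2 hwin), hεg g hg, hw g hg])]
    simp only [Fin.isValue, Matrix.cons_val_zero]
    have hS := sum_normSign_mul_normSign_one_add_mul_eq_zero hD h2 hwin R hR1' hR2' hR3' hσr
      (by rw [hvr2t]; exact (pow_le_pow_right_of_le_one' hϖ1.le (by omega : 1 ≤ 2 * j₁)).trans_eq (pow_one _))
    have hS' : ∑ g ∈ R, (normSign σ eB : ℚ) * normSign σ (1 + r * g) * (normSign σ g : ℚ) / 2 * ((1 : ℤ) : ℚ) * ((Wn : ℕ) : ℚ)⁻¹ =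
        (normSign σ eB : ℚ) / 2 * ((Wn : ℕ) : ℚ)⁻¹ * ((∑ g ∈ R, normSign σ g * normSign σ (1 + r * g) : ℤ) : ℚ) := by
      rw [Int.cast_sum, Finset.mul_sum]
      refine Finset.sum_congr rfl fun g _ => ?_
      push_cast; ring
    rw [hS', hS]; simp
  · rw [Finset.sum_congr rfl (fun g hg => by
      rw [hval g hg 0, if_neg (fun h => hwin ((forall_normSign_zero_mul_gluedChar_iff hD h2 hρ ht' (hR1' g hg).1 (hR1' g hg).2 (V₀ g) (hV₀ g) (hc g hg)
        (k := 2 * j₁) (by omega) (hck g hg).le).1 h))])]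
    simp

/-- **SLOT 1** (the read slot): the indicator is `[2d ≤ ρ + (n₂−ℓ₀−2ρ) + 1]` (★ p861560 §4); `Σ_{g ∈ R} ω(1+rg)` is `−#R∕(q−1)`-shaped on the boundary `n₂ + 2 = 2d + ℓ₀ + 2ρ`
(★ p861608 `sum_normSign_one_add_mul_boundary`) and `0` below it (`…_eq_zero`); beyond the cell the `(q−1)`-term is void. [cite: Rogawski1990, §4.9 Prop. 4.9.1 (b) p. 55] [cite: Serre1979, Ch. XV §2] -/
theorem card_mul_sum_value_one_eq (h2 : Valued.v (2 : K) < 1) (hD : IsRamifiedQuadraticDatum σ ϖ d t)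
    (hE : IsElementDatum σ ϖ (n0DerivedOfRecord d) α β n₁ n₂ n₃)
    (T : GL (Fin 3) K) (hT : (T : Matrix (Fin 3) (Fin 3) K) = Matrix.diagonal ![α, β, 1]) (ρ t' : ℕ) (hρ : 1 ≤ ρ) (ht' : 1 ≤ t')
    (hbey : n₂ < 2 * ρ + (d % 2 + 2 * d - 1)) (hread : 2 * ρ + 2 * t' + d % 2 = n₁) (hcap : 2 * ρ + 2 + d % 2 ≤ min n₂ n₃)
    {eB : K} (hσeB : σ eB = eB) (heB1 : Valued.v eB = 1)
    (R : Finset K) (hR1' : ∀ g ∈ R, σ g = g ∧ Valued.v g = Valued.v ϖ ^ (2 * t'))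
    (hR2' : ∀ f : K, σ f = f → Valued.v f = Valued.v ϖ ^ (2 * t') → ∃ g ∈ R, Valued.v (f - g) ≤ Valued.v ϖ ^ (ρ + 2 * t'))
    (hR3' : ∀ g ∈ R, ∀ g' ∈ R, Valued.v (g - g') ≤ Valued.v ϖ ^ (ρ + 2 * t') → g = g')
    (hRcard : R.card = (Nat.card 𝓀[K] - 1) * Nat.card 𝓀[K] ^ ((ρ + 1) / 2 - 1))
    (V₀ : K → GL (Fin 3) K) (hV₀ : ∀ g, (V₀ g : Matrix (Fin 3) (Fin 3) K) = !![1, 0, 0; 1, ϖ ^ ρ, 0; 1 * 1 + g, ϖ ^ ρ * 1, ϖ ^ (2 * ρ + 2 * t')])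
    {r : K} (hσr : σ r = r) (j₁ : ℕ) (hj₁ : n₂ = 2 * ρ + 2 * j₁ + d % 2)
    (hprecα : ∀ g ∈ R, Valued.v ((ϖ ^ (d % 2 + 2 * d - 1))⁻¹ * (((ϖ * σ ϖ) ^ (ρ + t'))⁻¹ * g *
      ((α - 1) - r * (eB * (ϖ * σ ϖ) ^ (ρ + t')) * ((ϖ - σ ϖ) * ((ϖ * σ ϖ) ^ ((d - d % 2) / 2))⁻¹)))) ≤ 1)
    (hprecβ : Valued.v ((ϖ ^ (d % 2 + 2 * d - 1))⁻¹ * (((ϖ * σ ϖ) ^ (ρ + t'))⁻¹ *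
      ((β - 1) - (eB * (ϖ * σ ϖ) ^ (ρ + t')) * ((ϖ - σ ϖ) * ((ϖ * σ ϖ) ^ ((d - d % 2) / 2))⁻¹)))) ≤ 1)
    (hvrg : ∀ g ∈ R, Valued.v (r * g) = Valued.v ϖ ^ (2 * j₁)) (hvr2t : Valued.v r * Valued.v ϖ ^ (2 * t') = Valued.v ϖ ^ (2 * j₁)) :
    ((((Nat.card 𝓀[K] - 1) * Nat.card 𝓀[K] ^ (ρ + 2 * t' - 1)) * ((Nat.card 𝓀[K] - 1) * Nat.card 𝓀[K] ^ (2 * ρ - 1)) : ℕ) : ℚ) *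
        ∑ g ∈ R, (labelledOddCount σ ϖ 0 1 (valueClassLabel σ ϖ (α - 1) (β - 1) (d % 2 + 2 * d - 1) d) (latt (V₀ g : Matrix (Fin 3) (Fin 3) K)) : ℚ) /
            ((((unitStabilizer (latt (V₀ g : Matrix (Fin 3) (Fin 3) K))).map (unitNormMap σ 3)).relIndex (fixedUnitTorus σ 3) : ℕ) : ℚ) =
      (normSign σ eB : ℚ) / 2 * (Nat.card 𝓀[K] : ℚ) ^ (2 * ρ + t' - 1) *
        ((if 2 * d + d % 2 + 2 * ρ ≤ n₂ then (Nat.card 𝓀[K] : ℚ) - 1 else 0) - (if n₂ + 2 = 2 * d + d % 2 + 2 * ρ then 1 else 0)) := by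
  classical
  obtain ⟨hσ, hvσ, hϖ, hfix, hdd, hd1, ht₂⟩ := id hD
  have hd2 : 2 ≤ d := two_le_d_of_v_two_lt_one hD h2
  obtain ⟨hϖ0, hϖ1⟩ := ne_zero_and_v_lt_one_of_v_eq_exp hϖ
  have hvϖ : 0 < Valued.v ϖ := (Valuation.pos_iff _).2 hϖ0
  have hσϖ0 : σ ϖ ≠ 0 := (map_ne_zero σ).2 hϖ0
  have hpw : ∀ a b : ℕ, Valued.v ϖ ^ a ≤ Valued.v ϖ ^ b ↔ b ≤ a := fun a b => by
    rw [v_varpi_pow hϖ, v_varpi_pow hϖ, WithZero.exp_le_exp]; omega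
  have hpwi : ∀ a b : ℕ, Valued.v ϖ ^ a = Valued.v ϖ ^ b ↔ a = b := fun a b => by
    rw [v_varpi_pow hϖ, v_varpi_pow hϖ, WithZero.exp_inj]; omega
  obtain ⟨-, -, -, -, -, -, -, -, hN1, hN2, hN3⟩ := id hE
  have hmcN : mcOfRecord d ≤ n0DerivedOfRecord d := mcOfRecord_le_n0DerivedOfRecord d
  have hmcv : mcOfRecord d = 2 * ((d % 2 + 2 * d - 1 + d) / 2) := rfl
  have hj₁1 : 1 ≤ j₁ := by omega
  have hj₁d : j₁ + 1 ≤ d := by omega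
  have hq1 : 1 < Nat.card 𝓀[K] := Finite.one_lt_card
  have h11 : Valued.v (1 : K) = 1 := map_one _
  have hπ0 : ((ϖ * σ ϖ) ^ (ρ + t') : K) ≠ 0 := pow_ne_zero _ (mul_ne_zero hϖ0 hσϖ0)
  have hσπ : σ ((ϖ * σ ϖ) ^ (ρ + t')) = (ϖ * σ ϖ) ^ (ρ + t') := by rw [map_pow, map_mul, hσ, mul_comm]
  have heB0 : eB ≠ 0 := fun h => by rw [h, map_zero] at heB1; exact zero_ne_one heB1
  have hσgβ : σ (eB * (ϖ * σ ϖ) ^ (ρ + t')) = eB * (ϖ * σ ϖ) ^ (ρ + t') := by rw [map_mul, hσeB, hσπ]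
  have hgβ0 : eB * (ϖ * σ ϖ) ^ (ρ + t') ≠ 0 := mul_ne_zero heB0 hπ0
  have hrglt : ∀ g ∈ R, Valued.v (r * g) < 1 := fun g hg => by rw [hvrg g hg]; exact pow_lt_one₀ zero_le hϖ1 (by omega)
  have h1rg0 : ∀ g ∈ R, (1 : K) + r * g ≠ 0 := fun g hg h => by
    have h' := Valued.v.map_one_add_of_lt (hrglt g hg); rw [h, map_zero] at h'; exact zero_ne_one h'
  have hσ1rg : ∀ g ∈ R, σ (1 + r * g) = 1 + r * g := fun g hg => by rw [map_add, map_one, map_mul, hσr, (hR1' g hg).1]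
  have hc : ∀ g ∈ R, σ (r * g / (1 + r * g)) = r * g / (1 + r * g) := fun g hg => by rw [map_div₀, hσ1rg g hg, map_mul, hσr, (hR1' g hg).1]
  have hck : ∀ g ∈ R, Valued.v (r * g / (1 + r * g)) = Valued.v ϖ ^ (2 * j₁) := fun g hg => by
    rw [map_div₀, Valued.v.map_one_add_of_lt (hrglt g hg), div_one, hvrg g hg]
  -- the per-orbit value (★ Orbits §5), `ε(g) = ω(e_B)ω(1+rg)`, the weight, the mass
  have hval := fun g (hg : g ∈ R) => value_latt_glued_rep_eq h2 hD hE T hT ρ t' hρ ht' hread hcap (hR1' g hg).1 (hR1' g hg).2 (V₀ g) (hV₀ g)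
    hσr hσgβ hgβ0 (hprecα g hg) hprecβ j₁ hj₁ (hvrg g hg)
  have hεg : ∀ g ∈ R, (normSign σ (eB * (ϖ * σ ϖ) ^ (ρ + t') * (1 + r * g)) : ℚ) = normSign σ eB * normSign σ (1 + r * g) := fun g hg =>
    normSign_unit_mul_normPow_mul hD hσeB heB1 (hσ1rg g hg) (h1rg0 g hg) (ρ + t')
  have hw : ∀ g ∈ R, stabiliserWeight σ (latt (V₀ g : Matrix (Fin 3) (Fin 3) K)) =
      ((((Nat.card 𝓀[K] - 1) * Nat.card 𝓀[K] ^ ((ρ + 2 * t' + 1) / 2 - 1)) * ((Nat.card 𝓀[K] - 1) * Nat.card 𝓀[K] ^ (ρ - 1)) : ℕ) : ℚ)⁻¹ := fun g hg =>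
    stabiliserWeight_latt_glued_tube_eq hσ hvσ hfix hϖ hdd hρ t' h11 h11 (hR1' g hg).2 (V₀ g) (hV₀ g) (hR1' g hg).1
      (by rw [map_one, (hR1' g hg).1, one_mul, sub_self, map_zero]; exact zero_le)
  have hmass := orbit_mass_eq_pow hq1 hρ t'
  have hj : (ρ + 2 * t' + 1) / 2 = (ρ + 1) / 2 + t' := by
    rw [show ρ + 2 * t' + 1 = ρ + 1 + t' * 2 by ring, Nat.add_mul_div_right _ _ (by norm_num : 0 < 2)]
  have e1 : 2 * ρ + 2 * t' - (ρ + 2 * t' + 1) / 2 + ((ρ + 1) / 2 - 1) = 2 * ρ + t' - 1 := by rw [hj]; omega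
  have epow : (Nat.card 𝓀[K] : ℚ) ^ (2 * ρ + t' - 1) =
      (Nat.card 𝓀[K] : ℚ) ^ (2 * ρ + 2 * t' - (ρ + 2 * t' + 1) / 2) * (Nat.card 𝓀[K] : ℚ) ^ ((ρ + 1) / 2 - 1) := by rw [← pow_add, e1]
  have hRcardQ : (R.card : ℚ) = ((Nat.card 𝓀[K] : ℚ) - 1) * (Nat.card 𝓀[K] : ℚ) ^ ((ρ + 1) / 2 - 1) := by
    rw [hRcard]; push_cast [Nat.cast_sub hq1.le]; ring
  set Wn : ℕ := ((Nat.card 𝓀[K] - 1) * Nat.card 𝓀[K] ^ ((ρ + 2 * t' + 1) / 2 - 1)) * ((Nat.card 𝓀[K] - 1) * Nat.card 𝓀[K] ^ (ρ - 1)) with hWn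
  set Nn : ℕ := ((Nat.card 𝓀[K] - 1) * Nat.card 𝓀[K] ^ (ρ + 2 * t' - 1)) * ((Nat.card 𝓀[K] - 1) * Nat.card 𝓀[K] ^ (2 * ρ - 1)) with hNn
  have key : ∀ x : ℚ, (Nn : ℚ) * (((Wn : ℕ) : ℚ)⁻¹ * x) = (Nat.card 𝓀[K] : ℚ) ^ (2 * ρ + 2 * t' - (ρ + 2 * t' + 1) / 2) * x := fun x => by
    rw [← mul_assoc, hmass]
  have hno₂ : ¬ (2 * d + d % 2 + 2 * ρ ≤ n₂) := by omega
  rw [if_neg hno₂, zero_sub]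
  by_cases hwin : 2 * d ≤ ρ + 2 * j₁ + 1
  · rw [Finset.sum_congr rfl (fun g hg => by
      rw [hval g hg 1, if_pos ((forall_normSign_one_mul_gluedChar_iff hD h2 hρ ht' (hR1' g hg).1 (hR1' g hg).2 (V₀ g) (hV₀ g) (hc g hg) (k := 2 * j₁) (by omega)
        (hck g hg)).2 hwin), hεg g hg, hw g hg])]
    simp only [Fin.isValue, Matrix.cons_val_one, Matrix.cons_val_zero]
    have hS' : ∑ g ∈ R, (normSign σ eB : ℚ) * normSign σ (1 + r * g) * ((1 : ℤ) : ℚ) / 2 * ((1 : ℤ) : ℚ) * ((Wn : ℕ) : ℚ)⁻¹ =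
        (normSign σ eB : ℚ) / 2 * ((Wn : ℕ) : ℚ)⁻¹ * ((∑ g ∈ R, normSign σ (1 + r * g) : ℤ) : ℚ) := by
      rw [Int.cast_sum, Finset.mul_sum]
      refine Finset.sum_congr rfl fun g _ => ?_
      push_cast; ring
    rw [hS', show (normSign σ eB : ℚ) / 2 * ((Wn : ℕ) : ℚ)⁻¹ * ((∑ g ∈ R, normSign σ (1 + r * g) : ℤ) : ℚ) =
        ((Wn : ℕ) : ℚ)⁻¹ * ((normSign σ eB : ℚ) / 2 * ((∑ g ∈ R, normSign σ (1 + r * g) : ℤ) : ℚ)) by ring, key]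
    by_cases hbd : j₁ + 1 = d
    · have hS := sum_normSign_one_add_mul_boundary hD h2 hd2 hρ R hR1' hR2' hR3' hσr (by rw [hvr2t, hpwi]; omega)
      rw [hS, if_pos (show n₂ + 2 = 2 * d + d % 2 + 2 * ρ by omega), epow]
      push_cast
      ring
    · have hS := sum_normSign_one_add_mul_eq_zero hD h2 (t' := j₁) hj₁1 (by omega) hwin R hR1' hR2' hR3' hσr hvr2t
      rw [hS, if_neg (show ¬ (n₂ + 2 = 2 * d + d % 2 + 2 * ρ) by omega)]
      simp
  · rw [Finset.sum_congr rfl (fun g hg => by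
      rw [hval g hg 1, if_neg (fun h => hwin ((forall_normSign_one_mul_gluedChar_iff hD h2 hρ ht' (hR1' g hg).1 (hR1' g hg).2 (V₀ g) (hV₀ g) (hc g hg)
        (k := 2 * j₁) (by omega) (hck g hg)).1 h))]),
      if_neg (show ¬ (n₂ + 2 = 2 * d + d % 2 + 2 * ρ) by omega)]
    simp

end Summit.HodgeConjecture.HodgeConjecture.Cruxes.H413.F0P3cDyRamLabelledOddBoundaryG1Slots

end
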